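import Summits.Ventures.PercRepro.CrossTwo

/-!
# Conditioning on an edge set, part A (p6, gen 4; split for the 400-line lint)

`forcePat` / `patWeight` (forced weights and product pattern weights), their insert/update calculus,
`patWeight_nonneg`, log-modularity `patWeight_mul_patWeight`, **`prob_eq_sum_forcePat`** (section `Force`).
The law-level consequences (`nestedSum`, the split and repair certificates) are in `ForceSet.lean`, which imports this file.
-/

namespace PercRepro

open Finset

section Force

variable {E : Type*} [DecidableEq E]

/-- Force the edges of `S` to the pattern `A` (open on `A`, closed on `S ∖ A`); keep `p` elsewhere. -/
def forcePat (p : E → ℝ) (S A : Finset E) : E → ℝ :=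
  fun e => if e ∈ S then (if e ∈ A then 1 else 0) else p e

/-- The product weight of the pattern `A` on `S`. -/
def patWeight (p : E → ℝ) (S A : Finset E) : ℝ := ∏ e ∈ S, if e ∈ A then p e else 1 - p e

/-- Forcing the empty edge set changes nothing. -/
theorem forcePat_empty (p : E → ℝ) (A : Finset E) : forcePat p ∅ A = p := by
  funext e; simp [forcePat]

/-- The weight of the empty pattern is `1`. -/
theorem patWeight_empty (p : E → ℝ) (A : Finset E) : patWeight p ∅ A = 1 := by
  simp [patWeight]

/-- Forcing `insert e S` to `insert e A` is forcing `S` to `A` after setting `p_e := 1`. -/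
theorem forcePat_insert_one (p : E → ℝ) {S : Finset E} {e : E} (he : e ∉ S) (A : Finset E) :
    forcePat (Function.update p e 1) S A = forcePat p (insert e S) (insert e A) := by
  funext x
  by_cases hx : x = e
  · subst hx; simp [forcePat, he]
  · simp [forcePat, hx]

/-- Forcing `insert e S` to `A ∌ e` is forcing `S` to `A` after setting `p_e := 0`. -/
theorem forcePat_insert_zero (p : E → ℝ) {S : Finset E} {e : E} (he : e ∉ S) {A : Finset E}
    (hA : e ∉ A) : forcePat (Function.update p e 0) S A = forcePat p (insert e S) A := by
  funext x
  by_cases hx : x = e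
  · subst hx; simp [forcePat, he, hA]
  · simp [forcePat, hx]

/-- The pattern weight does not see the value of `p` outside `S`. -/
theorem patWeight_update_of_notMem (p : E → ℝ) {S : Finset E} {e : E} (he : e ∉ S) (x : ℝ)
    (A : Finset E) : patWeight (Function.update p e x) S A = patWeight p S A := by
  unfold patWeight
  refine Finset.prod_congr rfl fun f hf => ?_
  have : f ≠ e := fun h => he (h ▸ hf)
  simp [Function.update_of_ne this]

/-- Pattern weight: an edge forced open contributes the factor `p e`. -/
theorem patWeight_insert_one (p : E → ℝ) {S : Finset E} {e : E} (he : e ∉ S) (A : Finset E) :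
    patWeight p (insert e S) (insert e A) = p e * patWeight p S A := by
  unfold patWeight
  rw [Finset.prod_insert he]
  simp only [Finset.mem_insert_self, if_true]
  congr 1
  refine Finset.prod_congr rfl fun f hf => ?_
  have : f ≠ e := fun h => he (h ▸ hf)
  simp [this]

/-- Pattern weight: an edge forced closed contributes the factor `1 - p e`. -/
theorem patWeight_insert_zero (p : E → ℝ) {S : Finset E} {e : E} (he : e ∉ S) {A : Finset E}
    (hA : e ∉ A) : patWeight p (insert e S) A = (1 - p e) * patWeight p S A := by
  unfold patWeight
  rw [Finset.prod_insert he, if_neg hA]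

/-- Pattern weights are nonnegative. -/
theorem patWeight_nonneg {p : E → ℝ} (hp : IsProb p) (S A : Finset E) : 0 ≤ patWeight p S A :=
  Finset.prod_nonneg fun e _ => by
    split_ifs
    · exact (hp e).1
    · linarith [(hp e).2]

/-- **Log-modularity** of the pattern weights: `w(A) w(A′) = w(A ∩ A′) w(A ∪ A′)`. -/
theorem patWeight_mul_patWeight (p : E → ℝ) (S A A' : Finset E) :
    patWeight p S A * patWeight p S A' = patWeight p S (A ∩ A') * patWeight p S (A ∪ A') := by
  unfold patWeight
  rw [← Finset.prod_mul_distrib, ← Finset.prod_mul_distrib]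
  refine Finset.prod_congr rfl fun e _ => ?_
  by_cases h1 : e ∈ A <;> by_cases h2 : e ∈ A' <;> simp [h1, h2, mul_comm]

/-- **Conditioning on the edges of `S`**: the probability of any event is the mixture of its
probabilities under the `2^|S|` forcings, with the pattern weights. -/
theorem prob_eq_sum_forcePat [Fintype E] (p : E → ℝ) (X : Set (Config E)) (S : Finset E) :
    prob p X = ∑ A ∈ S.powerset, patWeight p S A * prob (forcePat p S A) X := by
  induction S using Finset.induction_on generalizing p with
  | empty => simp [forcePat_empty, patWeight_empty]
  | insert e S he ih =>
    have hsplit := prob_update p e (p e) X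
    rw [Function.update_eq_self] at hsplit
    have hdisj : Disjoint S.powerset (S.powerset.image (insert e)) := by
      rw [Finset.disjoint_left]
      intro A hA hA'
      obtain ⟨B, _, rfl⟩ := Finset.mem_image.mp hA'
      exact he (Finset.mem_powerset.mp hA (Finset.mem_insert_self e B))
    have hinj : ∀ A ∈ S.powerset, ∀ B ∈ S.powerset, insert e A = insert e B → A = B := by
      intro A hA B hB h
      have heA : e ∉ A := fun h' => he (Finset.mem_powerset.mp hA h')
      have heB : e ∉ B := fun h' => he (Finset.mem_powerset.mp hB h')
      have := congrArg (fun T : Finset E => T.erase e) h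
      simpa [Finset.erase_insert heA, Finset.erase_insert heB] using this
    rw [hsplit, ih (Function.update p e 1), ih (Function.update p e 0), Finset.powerset_insert,
      Finset.sum_union hdisj, Finset.sum_image hinj, Finset.mul_sum, Finset.mul_sum, add_comm]
    congr 1
    · refine Finset.sum_congr rfl fun A hA => ?_
      have heA : e ∉ A := fun h => he (Finset.mem_powerset.mp hA h)
      rw [patWeight_update_of_notMem p he, patWeight_insert_zero p he heA,
        forcePat_insert_zero p he heA]
      ring
    · refine Finset.sum_congr rfl fun A _ => ?_
      rw [patWeight_update_of_notMem p he, patWeight_insert_one p he, forcePat_insert_one p he]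
      ring

/-- Forcing commutes with updating an edge outside `S`. -/
theorem forcePat_update_of_notMem (p : E → ℝ) {S : Finset E} {g : E} (hg : g ∉ S) (x : ℝ)
    (A : Finset E) : forcePat (Function.update p g x) S A = Function.update (forcePat p S A) g x := by
  funext e
  by_cases he : e = g
  · subst he; simp [forcePat, hg]
  · simp [forcePat, Function.update_of_ne he]

end Force

end PercRepro
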